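import Summits.Ventures.HodgeRepro.PlaneQuadCore
import Summits.Ventures.HodgeRepro.SingleClass

/-!
# The family `C₂ × C_p × C_p` (`p` an odd prime) carries no single-class `SumTwo` quadruple without a conjugate pair

Blind re-derivation cell `pub-hodge-repro`, seat `p1` (gen 12).  The family (ii) of P1.md §16g's «Consequence» —
the last paper-only EMPTY family of the abelian classification: `|G| = 2p² < 4p²`, so the two-generator rectangle
`(E_p)` is out of reach and `(A)`–`(D)` never apply; the census found it EMPTY at `p = 3, 5`.  This file proves the
emptiness for EVERY odd prime `p` on the typer's `Multiplicative (ZMod 2 × ZMod p × ZMod p)` with its unique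
involution `c = (1, 0)`:

**Theorem** (`exists_conj_of_sumTwo_C2xCpxCp`).  Every `SumTwo` quadruple of Galois twists of a CM type has two
complex-conjugate corners; hence (`not_isSingleClass_C2xCpxCp`, the census-row shape) no single-class `SumTwo`
quadruple of CM types without a conjugate pair exists.  Members: `p = 3` (order 18), `p = 5` (order 50, the largest
census case), `p = 7` (order 98, the informative case of the gen-11 census job j162904) and `p = 11` (order 242).

Proof.  Write `f = 1_Φ(0, ·)` for the indicator of the layer `{0} × V`, `V = ℤ/p × ℤ/p` (`layer`); the CM condition
is `1_Φ(1, y) = 1 − f(y)` (`layer_one`).  `SumTwo` at the point `(0, w)` reads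
`∑_{aᵢ = 0} f(w − yᵢ) + ∑_{aᵢ = 1} (1 − f(w − yᵢ)) = 2` for the twists `gᵢ = (aᵢ, yᵢ)` (`hsplit`).  Summing over `w`
gives `n₀ N₀ + n₁ (p² − N₀) = 2p²` with `N₀ = |Φ ∩ ({0} × V)|`, i.e. `(2 − n₁)(2N₀ − p²) = 0`; as `p²` is odd,
exactly two twists lie in each layer, `{i₀, i₁}` and `{j₀, j₁}`, and the relation becomes the four-point relation
`f(w − y_{i₀}) + f(w − y_{i₁}) = f(w − y_{j₀}) + f(w − y_{j₁})` of `PlaneQuadCore`.  By `periodic_of_fourRel`, `f`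
is periodic under `y_{j₀} − y_{i₀}` or `y_{j₁} − y_{i₀}`, and a period `y_j − y_i` with `a_i = 0`, `a_j = 1` is
exactly the conjugate pair `Φ g_j = c • Φ g_i` on both layers (`conj_of_periodic`).
-/

set_option autoImplicit false

open Finset Function
open scoped Pointwise

namespace HodgeRepro.PlaneQuad

variable {p : ℕ} [NeZero p]

/-! ### The group, its involution, and the layer indicators -/

/-- Complex conjugation `(1, 0)` of `C₂ × C_p × C_p` (its unique involution for `p` odd). -/
def cc2pp (p : ℕ) : Multiplicative (ZMod 2 × ZMod p × ZMod p) :=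
  Multiplicative.ofAdd ((1 : ZMod 2), (0 : ZMod p × ZMod p))

omit [NeZero p] in
/-- `(1, 0)` is a complex conjugation in the typer's sense. -/
theorem isComplexConj_cc2pp : IsComplexConj (cc2pp p) := by
  refine ⟨?_, ?_, fun g => mul_comm _ g⟩
  · intro h
    rw [cc2pp, ofAdd_eq_one, Prod.mk_eq_zero] at h
    exact absurd h.1 (by decide)
  · rw [cc2pp, ← ofAdd_add, Prod.mk_add_mk, add_zero, ofAdd_eq_one]
    have h11 : (1 : ZMod 2) + 1 = 0 := by decide
    exact Prod.ext h11 rfl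

/-- The indicator of the layer `{b} × V` of a subset `Φ`: `1_Φ(b, y)`, as a complex number. -/
noncomputable def layer (Φ : Finset (Multiplicative (ZMod 2 × ZMod p × ZMod p))) (b : ZMod 2)
    (y : ZMod p × ZMod p) : ℂ :=
  if Multiplicative.ofAdd (b, y) ∈ Φ then 1 else 0

omit [NeZero p] in
/-- The layer indicator takes the values `0` and `1`. -/
theorem layer_values (Φ : Finset (Multiplicative (ZMod 2 × ZMod p × ZMod p))) (b : ZMod 2)
    (y : ZMod p × ZMod p) : layer Φ b y = 0 ∨ layer Φ b y = 1 := by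
  unfold layer; split_ifs <;> simp

omit [NeZero p] in
/-- `1_Φ(b, y) = 1` iff `(b, y) ∈ Φ`. -/
theorem layer_eq_one_iff {Φ : Finset (Multiplicative (ZMod 2 × ZMod p × ZMod p))} {b : ZMod 2}
    {y : ZMod p × ZMod p} : layer Φ b y = 1 ↔ Multiplicative.ofAdd (b, y) ∈ Φ := by
  unfold layer; split_ifs with h <;> simp [h]

omit [NeZero p] in
/-- The CM condition on the layers: `1_Φ(1, y) = 1 − 1_Φ(0, y)`. -/
theorem layer_one {Φ : Finset (Multiplicative (ZMod 2 × ZMod p × ZMod p))} (hΦ : IsCMType (cc2pp p) Φ)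
    (y : ZMod p × ZMod p) : layer Φ 1 y = 1 - layer Φ 0 y := by
  have hmul : Multiplicative.ofAdd ((1 : ZMod 2), y) =
      cc2pp p * Multiplicative.ofAdd ((0 : ZMod 2), y) := by
    rw [cc2pp, ← ofAdd_add, Prod.mk_add_mk, add_zero, zero_add]
  have hcm := hΦ (Multiplicative.ofAdd ((0 : ZMod 2), y))
  unfold layer
  rw [hmul]
  by_cases h : Multiplicative.ofAdd ((0 : ZMod 2), y) ∈ Φ
  · rw [if_pos h, if_neg (hcm.mp h)]; norm_num
  · rw [if_neg h, if_pos (by by_contra h'; exact h (hcm.mpr h'))]; norm_num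

omit [NeZero p] in
/-- Membership in a Galois twist, in coordinates: `(b, w) ∈ Φ · (a, y) ↔ (b − a, w − y) ∈ Φ`. -/
theorem mem_rmul_ofAdd (Φ : Finset (Multiplicative (ZMod 2 × ZMod p × ZMod p))) (b a : ZMod 2)
    (w y : ZMod p × ZMod p) :
    Multiplicative.ofAdd (b, w) ∈ rmul Φ (Multiplicative.ofAdd (a, y)) ↔
      Multiplicative.ofAdd (b - a, w - y) ∈ Φ := by
  rw [mem_rmul, ← div_eq_mul_inv, ← ofAdd_sub, Prod.mk_sub_mk]

omit [NeZero p] in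
/-- A period `y_j − y_i` of the layer indicator, with `g_i` in the layer `0` and `g_j` in the layer `1`, is a
complex-conjugate pair of corners `Φ g_j = c • Φ g_i`. -/
theorem conj_of_periodic {Φ : Finset (Multiplicative (ZMod 2 × ZMod p × ZMod p))}
    (hΦ : IsCMType (cc2pp p) Φ) {a : Fin 4 → ZMod 2} {y : Fin 4 → ZMod p × ZMod p}
    {g : Fin 4 → Multiplicative (ZMod 2 × ZMod p × ZMod p)}
    (hg : ∀ i, g i = Multiplicative.ofAdd (a i, y i)) (i j : Fin 4) (hai : a i = 0) (haj : a j = 1)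
    (hper : ∀ z, layer Φ 0 (z + (y j - y i)) = layer Φ 0 z) :
    rmul Φ (g j) = cc2pp p • rmul Φ (g i) := by
  have hz2 : ∀ b : ZMod 2, b = 0 ∨ b = 1 := by decide
  ext x
  obtain ⟨⟨b, w⟩, rfl⟩ := Multiplicative.ofAdd.surjective x
  rw [(isComplexConj_cc2pp (p := p)).mem_smul_iff, hg i, hg j, mem_rmul_ofAdd, cc2pp, ← ofAdd_add,
    Prod.mk_add_mk, zero_add, mem_rmul_ofAdd, hai, haj, sub_zero]
  have hb : b - 1 = 1 + b := by rcases hz2 b with rfl | rfl <;> decide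
  have hw : w - y i = (w - y j) + (y j - y i) := by abel
  rw [hb, hw]
  rcases hz2 (1 + b) with h | h <;> rw [h]
  · rw [← layer_eq_one_iff, ← layer_eq_one_iff, hper]
  · rw [← layer_eq_one_iff, ← layer_eq_one_iff, layer_one hΦ, layer_one hΦ, hper]

/-! ### The theorem -/

/-- **`C₂ × C_p × C_p`, `p` an odd prime, `c = (1, 0)`.**  Every `SumTwo` quadruple of Galois twists of a CM type
has two complex-conjugate corners. -/
theorem exists_conj_of_sumTwo_C2xCpxCp (hp : p.Prime) (hp2 : p ≠ 2)
    (Φ : Finset (Multiplicative (ZMod 2 × ZMod p × ZMod p))) (hΦ : IsCMType (cc2pp p) Φ)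
    (g : Fin 4 → Multiplicative (ZMod 2 × ZMod p × ZMod p)) (hs : SumTwo (fun i => rmul Φ (g i))) :
    ∃ i j : Fin 4, rmul Φ (g j) = cc2pp p • rmul Φ (g i) := by
  have hz2 : ∀ b : ZMod 2, b = 0 ∨ b = 1 := by decide
  have h01 : (0 : ZMod 2) - 1 = 1 := by decide
  have h10 : (1 : ZMod 2) ≠ 0 := by decide
  -- coordinates of the quadruple
  obtain ⟨a, y, hg⟩ : ∃ (a : Fin 4 → ZMod 2) (y : Fin 4 → ZMod p × ZMod p),
      ∀ i, g i = Multiplicative.ofAdd (a i, y i) :=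
    ⟨fun i => (Multiplicative.toAdd (g i)).1, fun i => (Multiplicative.toAdd (g i)).2, fun i => by simp⟩
  have hs' : ∀ x, (univ.filter fun i => x ∈ rmul Φ (g i)).card = 2 := hs
  have hf01 : ∀ w, layer Φ 0 w = 0 ∨ layer Φ 0 w = 1 := layer_values Φ 0
  -- `SumTwo` at `(0, w)` as a sum of indicators
  have hsum : ∀ w : ZMod p × ZMod p,
      ∑ i, (if Multiplicative.ofAdd ((0 : ZMod 2), w) ∈ rmul Φ (g i) then (1 : ℂ) else 0) = 2 := by
    intro w
    rw [Finset.sum_boole, hs']; norm_num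
  have hterm : ∀ (w : ZMod p × ZMod p) (i : Fin 4),
      (if Multiplicative.ofAdd ((0 : ZMod 2), w) ∈ rmul Φ (g i) then (1 : ℂ) else 0) =
        if a i = 0 then layer Φ 0 (w - y i) else 1 - layer Φ 0 (w - y i) := by
    intro w i
    rw [hg i]
    by_cases hm : Multiplicative.ofAdd ((0 : ZMod 2), w) ∈ rmul Φ (Multiplicative.ofAdd (a i, y i))
    · rw [if_pos hm]
      rw [mem_rmul_ofAdd] at hm
      rcases hz2 (a i) with h | h
      · rw [h, sub_zero] at hm
        rw [if_pos h]
        exact (layer_eq_one_iff.mpr hm).symm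
      · rw [h, h01] at hm
        rw [if_neg (by rw [h]; exact h10)]
        have hl := layer_eq_one_iff.mpr hm
        rw [layer_one hΦ] at hl
        exact hl.symm
    · rw [if_neg hm]
      rw [mem_rmul_ofAdd] at hm
      rcases hz2 (a i) with h | h
      · rw [h, sub_zero] at hm
        rw [if_pos h]
        exact ((layer_values Φ 0 _).resolve_right (fun h1 => hm (layer_eq_one_iff.mp h1))).symm
      · rw [h, h01] at hm
        rw [if_neg (by rw [h]; exact h10)]
        have hl := (layer_values Φ 1 _).resolve_right (fun h1 => hm (layer_eq_one_iff.mp h1))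
        rw [layer_one hΦ] at hl
        exact hl.symm
  set I₀ := univ.filter (fun i : Fin 4 => a i = 0) with hI₀
  set I₁ := univ.filter (fun i : Fin 4 => ¬ a i = 0) with hI₁
  have hsplit : ∀ w, (∑ i ∈ I₀, layer Φ 0 (w - y i)) + ∑ i ∈ I₁, (1 - layer Φ 0 (w - y i)) = 2 := by
    intro w
    rw [← hsum w, ← Finset.sum_filter_add_sum_filter_not univ (fun i => a i = 0)]
    congr 1
    · exact Finset.sum_congr rfl (fun i hi => by rw [hterm, if_pos (Finset.mem_filter.mp hi).2])
    · exact Finset.sum_congr rfl (fun i hi => by rw [hterm, if_neg (Finset.mem_filter.mp hi).2])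
  -- the layer count: exactly two twists in each layer
  have hcardV : ((Fintype.card (ZMod p × ZMod p) : ℕ) : ℂ) = (p : ℂ) ^ 2 := by
    rw [Fintype.card_prod, ZMod.card]; push_cast; ring
  have hN : ∀ i, ∑ w, layer Φ 0 (w - y i) = ∑ w, layer Φ 0 w := fun i =>
    Fintype.sum_equiv (Equiv.subRight (y i)) _ _ (fun w => rfl)
  have hA : ∑ w : ZMod p × ZMod p, ∑ i ∈ I₀, layer Φ 0 (w - y i) = (I₀.card : ℂ) * ∑ w, layer Φ 0 w := by
    rw [Finset.sum_comm, Finset.sum_congr rfl (fun i _ => hN i), Finset.sum_const, nsmul_eq_mul]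
  have hB : ∑ w : ZMod p × ZMod p, ∑ i ∈ I₁, (1 - layer Φ 0 (w - y i)) =
      (I₁.card : ℂ) * ((p : ℂ) ^ 2 - ∑ w, layer Φ 0 w) := by
    rw [Finset.sum_comm]
    have hrow : ∀ i ∈ I₁, ∑ w : ZMod p × ZMod p, (1 - layer Φ 0 (w - y i)) =
        (p : ℂ) ^ 2 - ∑ w, layer Φ 0 w := by
      intro i _
      rw [Finset.sum_sub_distrib, hN i, Finset.sum_const, Finset.card_univ, nsmul_eq_mul, mul_one, hcardV]
    rw [Finset.sum_congr rfl hrow, Finset.sum_const, nsmul_eq_mul]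
  have htot : (I₀.card : ℂ) * ∑ w, layer Φ 0 w + (I₁.card : ℂ) * ((p : ℂ) ^ 2 - ∑ w, layer Φ 0 w) =
      2 * (p : ℂ) ^ 2 := by
    have h1 : ∑ w : ZMod p × ZMod p,
        ((∑ i ∈ I₀, layer Φ 0 (w - y i)) + ∑ i ∈ I₁, (1 - layer Φ 0 (w - y i))) =
        ∑ w : ZMod p × ZMod p, (2 : ℂ) := Finset.sum_congr rfl (fun w _ => hsplit w)
    rw [Finset.sum_add_distrib, hA, hB, Finset.sum_const, Finset.card_univ, nsmul_eq_mul, hcardV] at h1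
    rw [h1]; ring
  have hN₀ : ∑ w, layer Φ 0 w =
      ((univ.filter fun w : ZMod p × ZMod p => Multiplicative.ofAdd ((0 : ZMod 2), w) ∈ Φ).card : ℂ) := by
    unfold layer; rw [Finset.sum_boole]
  set M := (univ.filter fun w : ZMod p × ZMod p => Multiplicative.ofAdd ((0 : ZMod 2), w) ∈ Φ).card with hM
  rw [hN₀] at htot
  have hnm : I₀.card + I₁.card = 4 := by
    rw [hI₀, hI₁, Finset.card_filter_add_card_filter_not, Finset.card_univ, Fintype.card_fin]
  have hnat : I₀.card * M + I₁.card * p ^ 2 = 2 * p ^ 2 + I₁.card * M := by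
    have h2 : ((I₀.card * M + I₁.card * p ^ 2 : ℕ) : ℂ) = ((2 * p ^ 2 + I₁.card * M : ℕ) : ℂ) := by
      push_cast; linear_combination htot
    exact_mod_cast h2
  have hI₁two : I₁.card = 2 := by
    have hz : ((2 : ℤ) - I₁.card) * (2 * M - (p : ℤ) ^ 2) = 0 := by
      have hnat' : (I₀.card : ℤ) * M + I₁.card * (p : ℤ) ^ 2 = 2 * (p : ℤ) ^ 2 + I₁.card * M := by
        exact_mod_cast hnat
      have hnm' : (I₀.card : ℤ) + I₁.card = 4 := by exact_mod_cast hnm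
      linear_combination hnat' - (M : ℤ) * hnm'
    rcases mul_eq_zero.mp hz with h | h
    · have : (I₁.card : ℤ) = 2 := by linear_combination -h
      exact_mod_cast this
    · exfalso
      have h2M : 2 * M = p ^ 2 := by
        have : (2 * M : ℤ) = (p : ℤ) ^ 2 := by linear_combination h
        exact_mod_cast this
      have hev : Even (p ^ 2) := ⟨M, by omega⟩
      exact hp2 (hp.even_iff.mp (Nat.even_pow.mp hev).1)
  have hI₀two : I₀.card = 2 := by omega
  -- the two twists of each layer
  obtain ⟨i₀, i₁, hi, hI₀eq⟩ := Finset.card_eq_two.mp hI₀two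
  obtain ⟨j₀, j₁, hj, hI₁eq⟩ := Finset.card_eq_two.mp hI₁two
  have hai₀ : a i₀ = 0 := by
    have hmem : i₀ ∈ univ.filter (fun i : Fin 4 => a i = 0) := by
      rw [← hI₀, hI₀eq]; exact Finset.mem_insert_self i₀ {i₁}
    exact (Finset.mem_filter.mp hmem).2
  have haj : ∀ j, j ∈ univ.filter (fun i : Fin 4 => ¬ a i = 0) → a j = 1 := fun j hj =>
    (hz2 (a j)).resolve_left (Finset.mem_filter.mp hj).2
  have haj₀ : a j₀ = 1 := haj j₀ (by rw [← hI₁, hI₁eq]; exact Finset.mem_insert_self j₀ {j₁})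
  have haj₁ : a j₁ = 1 := haj j₁ (by
    rw [← hI₁, hI₁eq]; exact Finset.mem_insert_of_mem (Finset.mem_singleton_self j₁))
  -- the four-point relation on the layer `0`
  have hrel : ∀ w, layer Φ 0 (w - y i₀) + layer Φ 0 (w - y i₁) =
      layer Φ 0 (w - y j₀) + layer Φ 0 (w - y j₁) := by
    intro w
    have h := hsplit w
    rw [hI₀eq, hI₁eq, Finset.sum_pair hi, Finset.sum_pair hj] at h
    linear_combination h
  rcases periodic_of_fourRel hp hp2 hf01 (y i₀) (y i₁) (y j₀) (y j₁) hrel with hper | hper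
  · exact ⟨i₀, j₀, conj_of_periodic hΦ hg i₀ j₀ hai₀ haj₀ hper⟩
  · exact ⟨i₀, j₁, conj_of_periodic hΦ hg i₀ j₁ hai₀ haj₁ hper⟩

/-- **Corollary in the shape of `QuadFinset12`'s `not_isSingleClass_<G>`**: on `C₂ × C_p × C_p` (`p` an odd
prime) no single-class `SumTwo` quadruple of CM types without a conjugate pair exists. -/
theorem not_isSingleClass_C2xCpxCp (hp : p.Prime) (hp2 : p ≠ 2)
    (T : Fin 4 → Finset (Multiplicative (ZMod 2 × ZMod p × ZMod p))) (hT : IsCMType (cc2pp p) (T 0))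
    (hs : SumTwo T) (hnc : ∀ i j : Fin 4, T j ≠ cc2pp p • T i) : ¬ IsSingleClass T := by
  intro hsc
  choose g hg using hsc
  have hT' : T = fun i => rmul (T 0) (g i) := funext hg
  have hs' : SumTwo (fun i => rmul (T 0) (g i)) := by rw [← hT']; exact hs
  obtain ⟨i, j, hij⟩ := exists_conj_of_sumTwo_C2xCpxCp hp hp2 (T 0) hT g hs'
  exact hnc i j (by rw [hg j, hg i]; exact hij)

/-! ### The first members: `p = 3, 5, 7, 11` -/

/-- `C₂ × C₃ × C₃` (order 18). -/
abbrev C2xC3xC3 : Type := Multiplicative (ZMod 2 × ZMod 3 × ZMod 3)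

/-- `(C₂ × C₃ × C₃, (1, 0))`: no single-class `SumTwo` quadruple without a conjugate pair (census EMPTY). -/
theorem not_isSingleClass_C2xC3xC3 (T : Fin 4 → Finset C2xC3xC3) (hT : IsCMType (cc2pp 3) (T 0))
    (hs : SumTwo T) (hnc : ∀ i j : Fin 4, T j ≠ cc2pp 3 • T i) : ¬ IsSingleClass T :=
  not_isSingleClass_C2xCpxCp (by norm_num) (by norm_num) T hT hs hnc

/-- `C₂ × C₅ × C₅` (order 50). -/
abbrev C2xC5xC5 : Type := Multiplicative (ZMod 2 × ZMod 5 × ZMod 5)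

/-- `(C₂ × C₅ × C₅, (1, 0))`: no single-class `SumTwo` quadruple without a conjugate pair (census EMPTY, the
largest census case of the family). -/
theorem not_isSingleClass_C2xC5xC5 (T : Fin 4 → Finset C2xC5xC5) (hT : IsCMType (cc2pp 5) (T 0))
    (hs : SumTwo T) (hnc : ∀ i j : Fin 4, T j ≠ cc2pp 5 • T i) : ¬ IsSingleClass T :=
  not_isSingleClass_C2xCpxCp (by norm_num) (by norm_num) T hT hs hnc

/-- `C₂ × C₇ × C₇` (order 98). -/
abbrev C2xC7xC7 : Type := Multiplicative (ZMod 2 × ZMod 7 × ZMod 7)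

/-- `(C₂ × C₇ × C₇, (1, 0))`: no single-class `SumTwo` quadruple without a conjugate pair — the informative case of
the gen-11 census job j162904, now a theorem. -/
theorem not_isSingleClass_C2xC7xC7 (T : Fin 4 → Finset C2xC7xC7) (hT : IsCMType (cc2pp 7) (T 0))
    (hs : SumTwo T) (hnc : ∀ i j : Fin 4, T j ≠ cc2pp 7 • T i) : ¬ IsSingleClass T :=
  not_isSingleClass_C2xCpxCp (by norm_num) (by norm_num) T hT hs hnc

/-- `C₂ × C₁₁ × C₁₁` (order 242). -/
abbrev C2xC11xC11 : Type := Multiplicative (ZMod 2 × ZMod 11 × ZMod 11)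

/-- `(C₂ × C₁₁ × C₁₁, (1, 0))`: no single-class `SumTwo` quadruple without a conjugate pair (beyond every
census). -/
theorem not_isSingleClass_C2xC11xC11 (T : Fin 4 → Finset C2xC11xC11) (hT : IsCMType (cc2pp 11) (T 0))
    (hs : SumTwo T) (hnc : ∀ i j : Fin 4, T j ≠ cc2pp 11 • T i) : ¬ IsSingleClass T :=
  not_isSingleClass_C2xCpxCp (by norm_num) (by norm_num) T hT hs hnc

end HodgeRepro.PlaneQuad
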